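import Summits.HodgeConjecture.HodgeConjecture.Theorems.R90S4U2OuterSimilSwap       -- ★ p03: brings ★ p05 `formCongr_glDiagonal_two_eq_smul`, ★ `cmDatumLocalCongr` + `coe_cmDatumLocalCongr_apply`, ★ `QuadraticLocalNormGroupNonsplit`
import Summits.HodgeConjecture.HodgeConjecture.Theorems.R90S4U2UnipotentTorusWord    -- ★ p01 (f₁) `exists_unipotentU_two_coe_eq`; brings ★ `antidiagonal_two_over_eq`, `coe_eq_of_mem_unipotentU_two`, `coe_glDiagonal_two_mul_mul_inv_apply`
import Literature.NumberTheory.Automorphic.TwistedJacquetAdditive                  -- ★ `TwistedJacquet.ball`, `exists_ball_subset_of_mem_nhds`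
import Literature.NumberTheory.Automorphic.AdditiveCharacterDuality                 -- ★ `AddCharDuality.exists_forall_lt_apply_eq_one` (continuous additive characters have open kernel)
import Literature.NumberTheory.Automorphic.AdeleGaloisDescent                       -- ★ `isClosedEmbedding_adicCompletionOfLiesOver` (`ι_w : F_v → E_w` is a closed embedding)
import Literature.NumberTheory.Automorphic.Liu2021.LemD1IsotropyOfPlace             -- ★ `LemD1OfPlace.exists_toLocalRing_eq_of_conjLocal_eq` (`σ`-fixed ⇒ in `ι_v(F_v)`)
import Literature.NumberTheory.Automorphic.AdicCompletionLocalField                 -- ★ instances: `F_v = v.adicCompletion F` is a non-archimedean local field (`ValuativeRel`, …)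
import HarnessLib

/-!
# R90-TF · S4 «Ch. 13.1–2» — (SWAP) road, brick (b′) «U(1,1) ONE-PARAMETER FRAME»: the unipotent radical `N(L⁺_v)` of `U(Φ₂)(L⁺_v)` as the
# one-parameter group `x ↦ u(ι_v(x) δ₀)` of the local field `F_v = L⁺_v`, with its Whittaker characters, torus and outer-similitude rescalings

Cell `hodgecm-mathlib`, crux H413 (`stmt-HodgeConjecture-24833`, lane `--supports … --as helper`), route of record `HCCMUnconditional`
(count-neutral).  Programme R90-TF, section S4 = Rogawski Ch. 13.1–2 (base `R90-C131`, dealer K2E2-plan (g6)); seat K2E3-p11 (g9) (W5 SWAP hand,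
RULING S4-R10; «SWAP-b FRAME»).  THEOREMS ONLY (no `def` ∕ instance ∕ notation ∕ named fact ∕ `sorry`); ★-only imports; never imports `Cruxes/…/Lines`.

THE POINT.  The Whittaker road to (SWAP) = B `stub_R90_S4_U2_ldsSwap` has ★ bricks in the ONE-PARAMETER currency of ★ `TwistedJacquetAdditive` (`e : F → G`
additive, smooth action, twisted spans `V(ψ_a)`: ★ (e) `R90S4DegenerateUnipotentTrivial`, ★ (b) `R90S4TwistedSpanTransport` incl. the bridge
`ker_charTwist_eq_twistedSpan`) and in the subgroup currency (★ (a) `R90S4U2TwistedCoinvariantsLeOne`: `θ : ↥N →* ℂˣ`, open kernel, `θ ≠ 1`; ★ (c) slot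
lemma; ★ (f₁); ★ (STAB); ★ p03 `swap_of_two_of_exists_moved`).  This file is the DICTIONARY at the CM datum: `F_v := v.adicCompletion L⁺` (★ a
non-archimedean local field), `ι_v = toLocalRing L v`, `σ = c ⊗ 1`, a SKEW `δ₀ ∈ E_v` (★ `exists_skew_unit_localRing`), `e(x) = u(ι_v(x) δ₀) ∈ G₂ = U(Φ₂)(L⁺_v)`.
Everything derives from the MATRIX LAW `(H) ∀ x, ↑(e x) = [[1, ι_v x · δ₀], [0, 1]]`; consumers `obtain ⟨e, he⟩` from §2 and feed `he` to §3–§6: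
§1 generic `2 × 2` bookkeeping · §2 EXISTENCE of `e` with (H) · §3 LAWS: additivity, `e 0 = 1`, `e x ∈ N = (cmBorelTriple L 2 v).N`, continuity, injectivity,
SURJECTIVITY onto `N`, and ★ (e)'s SMOOTHNESS clause for every smooth `ρ` · §4 WHITTAKER CHARACTERS `θ : ↥N →* ℂˣ` with OPEN kernel, `θ(e x) = ψ(c x)`, `θ ≠ 1`
(the `hθ`, `hθ1` of ★ (a), the bridge hypotheses of ★ (b)) · §5 TORUS RESCALING by NORMS · §6 OUTER SIMILITUDE `Ad(diag(ι_v a, 1)) e(x) = e(a x)`.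
[Rogawski1990, §1.9–§1.10 pp. 8–9, §11.1 p. 161] [LabesseLanglands1979] [Bump1997, §4.4 p. 460]

HONEST LABEL: HC_CM is proved only modulo the 7 printed citations (2 remaining named inputs: hLiu418 = stmt-HodgeConjecture-24832,
h413 = stmt-HodgeConjecture-24833) until rung 0 closes; plumbing toward (SWAP), which stays OPEN until the assembly lands and B re-ties.  REL ≠ ★ ≠ BUILT.

## Mathlib ∕ tree search
Tree ★ reused by import: `exists_unipotentU_two_coe_eq`, `coe_eq_of_mem_unipotentU_two`, `antidiagonal_two_over_eq`, `coe_glDiagonal_two_mul_mul_inv_apply`,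
`cmLocalForm_eq_over`, `toLocalRing{,_injective,_apply}`, `continuous_toLocalRing`, `conjLocal_toLocalRing`, `conjLocal_conjLocal_cm`, `isClosedEmbedding_adicCompletionOfLiesOver`,
`LemD1OfPlace.exists_toLocalRing_eq_of_conjLocal_eq`, `AddCharDuality.exists_forall_lt_apply_eq_one`, `formCongr_glDiagonal_two_eq_smul`, `coe_cmDatumLocalCongr_apply`.
Mathlib: `Units.continuous_iff`, `continuous_matrix`, `Subgroup.isOpen_of_mem_nhds`, `IsValuativeTopology.mem_nhds_zero_iff`, `Circle.toUnits`.  Dedup `rg "oneParam"`: none.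

## References
* [Rogawski1990] J. D. Rogawski, *Automorphic Representations of Unitary Groups in Three Variables*, Ann. of Math. Stud. 123 (1990), §1.9–§1.10 pp. 8–9, §11.1 p. 161.
* [LabesseLanglands1979] J.-P. Labesse, R. P. Langlands, *L-indistinguishability for SL(2)*, Canad. J. Math. 31 (1979), 726–785.
* [Bump1997] D. Bump, *Automorphic Forms and Representations* (1997), §4.4 p. 460.
* [PlatonovRapinchuk1994] V. Platonov, A. Rapinchuk, *Algebraic Groups and Number Theory* (1994), §2.3, §5.1.
* [BernsteinZelevinsky1976] Bernstein–Zelevinsky, Russian Math. Surveys 31:3 (1976), §2.1 · [CasselsFrohlichANT1967] Cassels–Fröhlich, *Algebraic Number Theory* (1967), Ch. II §10.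
-/

set_option autoImplicit false
-- the mandated namespace (brief §3.4) repeats the single-problem summit's segment (`HodgeConjecture.HodgeConjecture`)
set_option linter.dupNamespace false

noncomputable section

open scoped Matrix MatrixGroups Topology
open NumberField IsDedekindDomain
open Literature.NumberTheory.Automorphic Literature.NumberTheory.Automorphic.UnitaryGroup Literature.NumberTheory.Automorphic.TwistedJacquet

namespace Summit.HodgeConjecture.HodgeConjecture.R90.S4

open Summit.HodgeConjecture.HodgeConjecture.Cruxes.H413.F0P3bBorelCharactersUnipotentTwo

/-! ## §1 Generic `2 × 2` bookkeeping for `U(σ, Φ₂)(R)` -/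

section Generic

variable {R : Type*} [CommRing R] (σ : R →+* R)

/-- **The `(0,1)` entry of an element of `N ≤ U(σ, Φ₂)(R)` is SKEW**: `ᵗ(σu) Φ₂ u = [[0, 1], [1, s + σ s]] = Φ₂` forces `σ s = −s` (`J` given as `Φ₂` by an
equation, the shape of ★ `cmBorelTriple`). [cite: Rogawski1990, §1.10 p. 9] -/
theorem map_entry_eq_neg_of_mem_unipotentU_two {J : Matrix (Fin 2) (Fin 2) R} (hJ : J = (StdForm.antidiagonal 2).over R)
    {u : ↥(unitaryGroupOfForm σ J)} (hu : u ∈ unipotentU σ J) :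
    σ (((u : GL (Fin 2) R) : Matrix (Fin 2) (Fin 2) R) 0 1) = -((u : GL (Fin 2) R) : Matrix (Fin 2) (Fin 2) R) 0 1 := by
  subst hJ
  have hcoe := coe_eq_of_mem_unipotentU_two σ hu
  have hmem := mem_unitaryGroupOfForm_iff.1 u.2
  rw [hcoe] at hmem
  have h11 := congrArg (fun M : Matrix (Fin 2) (Fin 2) R => M 1 1) hmem
  simp [Matrix.mul_apply, Fin.sum_univ_two, Matrix.map_apply, Matrix.transpose_apply, antidiagonal_two_over_eq] at h11
  linear_combination h11

/-- **Matrix form of an element of `N`** (`J` given as `Φ₂` by an equation): `u = [[1, u₀₁], [0, 1]]` (★ `coe_eq_of_mem_unipotentU_two`). [cite: Rogawski1990, §1.10 p. 9] -/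
theorem coe_eq_of_mem_unipotentU_two_of_eq {J : Matrix (Fin 2) (Fin 2) R} (hJ : J = (StdForm.antidiagonal 2).over R)
    {u : ↥(unitaryGroupOfForm σ J)} (hu : u ∈ unipotentU σ J) :
    ((u : GL (Fin 2) R) : Matrix (Fin 2) (Fin 2) R) = !![1, ((u : GL (Fin 2) R) : Matrix (Fin 2) (Fin 2) R) 0 1; 0, 1] := by
  subst hJ
  exact coe_eq_of_mem_unipotentU_two σ hu

/-- **Existence of `u(x) ∈ U(σ, Φ₂)(R)` with matrix `[[1, x], [0, 1]]` for skew `x`** (★ p01 `exists_unipotentU_two_coe_eq`, `J = Φ₂` by an equation). [cite: Rogawski1990, §1.10 p. 9] -/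
theorem exists_unipotentU_two_coe_eq_of_eq {J : Matrix (Fin 2) (Fin 2) R} (hJ : J = (StdForm.antidiagonal 2).over R) (x : R) (hx : σ x = -x) :
    ∃ u : ↥(unitaryGroupOfForm σ J), u ∈ unipotentU σ J ∧ ((u : GL (Fin 2) R) : Matrix (Fin 2) (Fin 2) R) = !![1, x; 0, 1] := by
  subst hJ
  exact exists_unipotentU_two_coe_eq σ x hx

/-- An element with upper-unitriangular matrix `[[1, s], [0, 1]]` lies in `N`. [cite: Rogawski1990, §1.10 p. 9] -/
theorem mem_unipotentU_of_coe_eq {J : Matrix (Fin 2) (Fin 2) R} (u : ↥(unitaryGroupOfForm σ J)) (s : R)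
    (hu : ((u : GL (Fin 2) R) : Matrix (Fin 2) (Fin 2) R) = !![1, s; 0, 1]) : u ∈ unipotentU σ J := by
  rw [mem_unipotentU_iff]
  refine ⟨?_, fun i => ?_⟩
  · intro i j hij
    rw [hu]
    fin_cases i <;> fin_cases j <;> simp_all
  · rw [hu]
    fin_cases i <;> simp

/-- **The torus element `d(α, (σα)⁻¹)` lies in `U(σ, Φ₂)(R)`** for a unit `α` with `σ (σ α) = α`: `ᵗ(σd) Φ₂ d = Φ₂`. [cite: Rogawski1990, §1.10 p. 9] -/
theorem glDiagonal_two_mem_unitaryGroupOfForm_of_eq {J : Matrix (Fin 2) (Fin 2) R} (hJ : J = (StdForm.antidiagonal 2).over R)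
    (α : Rˣ) (hσσ : σ (σ (α : R)) = α) :
    glDiagonal 2 R ![α, (Units.map (σ : R →* R) α)⁻¹] ∈ unitaryGroupOfForm σ J := by
  subst hJ
  have h1 : σ (α : R) * σ ((α⁻¹ : Rˣ) : R) = 1 := by rw [← map_mul, Units.mul_inv, map_one]
  have h2 : σ (σ ((α⁻¹ : Rˣ) : R)) * (α : R) = 1 := by
    calc σ (σ ((α⁻¹ : Rˣ) : R)) * (α : R) = σ (σ ((α⁻¹ : Rˣ) : R)) * σ (σ (α : R)) := by rw [hσσ]
      _ = 1 := by rw [← map_mul, ← map_mul, Units.inv_mul, map_one, map_one]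
  rw [mem_unitaryGroupOfForm_iff, antidiagonal_two_over_eq, coe_glDiagonal]
  ext i j
  fin_cases i <;> fin_cases j <;>
    simp [Matrix.mul_apply, Fin.sum_univ_two, Matrix.diagonal, Matrix.map_apply, Matrix.transpose_apply, h1, h2]

/-- **Diagonal conjugation of a unipotent matrix**: `diag(d₀, d₁) [[1, s], [0, 1]] diag(d₀, d₁)⁻¹ = [[1, d₀ s d₁⁻¹], [0, 1]]`. [cite: Rogawski1990, §1.10 p. 9] -/
theorem coe_glDiagonal_conj_unipotent_two (d₀ d₁ : Rˣ) {g : GL (Fin 2) R} {s : R} (hg : (g : Matrix (Fin 2) (Fin 2) R) = !![1, s; 0, 1]) :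
    ((glDiagonal 2 R ![d₀, d₁] * g * (glDiagonal 2 R ![d₀, d₁])⁻¹ : GL (Fin 2) R) : Matrix (Fin 2) (Fin 2) R) =
      !![1, (d₀ : R) * s * ((d₁⁻¹ : Rˣ) : R); 0, 1] := by
  ext i j
  rw [coe_glDiagonal_two_mul_mul_inv_apply, hg]
  fin_cases i <;> fin_cases j <;> simp

end Generic

/-! ## §2–§6 The CM datum: `G₂ = U(Φ₂)(L⁺_v)`, `F_v = v.adicCompletion L⁺`, `ι_v = toLocalRing L v`, a skew `δ₀` -/

section CM

variable (L : Type) [Field L] [NumberField L] [IsCMField L] (v : HeightOneSpectrum (𝓞 ↥(maximalRealSubfield L)))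
  {δ₀ : LocalRing L v} (hδ₀ : conjLocal L (IsCMField.complexConj L) v δ₀ = -δ₀)
  {e : v.adicCompletion ↥(maximalRealSubfield L) → ↥(unitaryGroupOfForm (conjLocal L (IsCMField.complexConj L) v) (cmLocalForm L 2 v))}
  (he : ∀ x, (e x : GL (Fin 2) (LocalRing L v)).val = !![1, toLocalRing L v x * δ₀; 0, 1])

/-! ### §2 Existence of the one-parameter map -/

include hδ₀ in
/-- `ι_v(x) · δ₀` is skew for every `x ∈ F_v` (`ι_v(F_v)` is `σ`-fixed, ★ `conjLocal_toLocalRing`). [cite: Rogawski1990, §1.9 p. 8] -/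
theorem conjLocal_toLocalRing_mul_skew (x : v.adicCompletion ↥(maximalRealSubfield L)) :
    conjLocal L (IsCMField.complexConj L) v (toLocalRing L v x * δ₀) = -(toLocalRing L v x * δ₀) := by
  rw [map_mul, conjLocal_toLocalRing, hδ₀, mul_neg]

include hδ₀ in
/-- **EXISTENCE of the one-parameter map `e : F_v → U(Φ₂)(L⁺_v)` with the matrix law (H) `↑(e x) = [[1, ι_v(x) δ₀], [0, 1]]`** (choice over ★ p01
`exists_unipotentU_two_coe_eq` and ★ `cmLocalForm_eq_over`). [cite: Rogawski1990, §1.10 p. 9] -/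
theorem exists_oneParam_two :
    ∃ e : v.adicCompletion ↥(maximalRealSubfield L) → ↥(unitaryGroupOfForm (conjLocal L (IsCMField.complexConj L) v) (cmLocalForm L 2 v)),
      ∀ x, (e x : GL (Fin 2) (LocalRing L v)).val = !![1, toLocalRing L v x * δ₀; 0, 1] :=
  ⟨fun x => Classical.choose (exists_unipotentU_two_coe_eq_of_eq (conjLocal L (IsCMField.complexConj L) v) (cmLocalForm_eq_over L 2 v)
      (toLocalRing L v x * δ₀) (conjLocal_toLocalRing_mul_skew L v hδ₀ x)),
    fun x => (Classical.choose_spec (exists_unipotentU_two_coe_eq_of_eq (conjLocal L (IsCMField.complexConj L) v) (cmLocalForm_eq_over L 2 v)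
      (toLocalRing L v x * δ₀) (conjLocal_toLocalRing_mul_skew L v hδ₀ x))).2⟩

/-! ### §3 Laws from the matrix law (H) -/

include he in
/-- `e x ∈ N = (cmBorelTriple L 2 v).N` (upper unitriangular). [cite: Rogawski1990, §1.10 p. 9] -/
theorem oneParam_mem_N (x : v.adicCompletion ↥(maximalRealSubfield L)) : e x ∈ (cmBorelTriple L 2 v).N :=
  mem_unipotentU_of_coe_eq (conjLocal L (IsCMField.complexConj L) v) (e x) _ (he x)

include he in
/-- **Additivity**: `e (x + y) = e x * e y` (`[[1, a], [0, 1]] [[1, b], [0, 1]] = [[1, a + b], [0, 1]]`). [cite: Rogawski1990, §1.10 p. 9] -/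
theorem oneParam_add (x y : v.adicCompletion ↥(maximalRealSubfield L)) : e (x + y) = e x * e y := by
  apply Subtype.ext
  apply Units.ext
  change (e (x + y) : GL (Fin 2) (LocalRing L v)).val = ((e x : GL (Fin 2) (LocalRing L v)) * (e y : GL (Fin 2) (LocalRing L v))).val
  rw [Units.val_mul, he, he, he, map_add, add_mul, Matrix.mul_fin_two]
  simp only [mul_one, mul_zero, add_zero, zero_add, one_mul, zero_mul, add_comm]

include he in
/-- `e 0 = 1` and `e (-x) = (e x)⁻¹` (group laws from additivity). [cite: Rogawski1990, §1.10 p. 9] -/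
theorem oneParam_zero_and_neg : e 0 = 1 ∧ ∀ x, e (-x) = (e x)⁻¹ := by
  have h0 : e 0 = 1 := by
    have h := oneParam_add L v he 0 0
    rw [add_zero] at h
    exact mul_eq_left.1 h.symm
  exact ⟨h0, fun x => by rw [eq_inv_iff_mul_eq_one, ← oneParam_add L v he, neg_add_cancel, h0]⟩

include he in
/-- **Continuity of `e`** (entries continuous, ★ `continuous_toLocalRing`; units and subgroup carry induced topologies), recorded together with `e 0 = 1`
(the pair used by the smoothness clause). [cite: PlatonovRapinchuk1994, §5.1] -/
theorem continuous_oneParam_and_zero : Continuous e ∧ e 0 = 1 := by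
  refine ⟨?_, (oneParam_zero_and_neg L v he).1⟩
  rw [Topology.IsInducing.subtypeVal.continuous_iff, Units.continuous_iff]
  have hι : Continuous (toLocalRing L v) := continuous_toLocalRing L v
  have hc : ∀ f : v.adicCompletion ↥(maximalRealSubfield L) → v.adicCompletion ↥(maximalRealSubfield L), Continuous f →
      Continuous fun x => (!![1, toLocalRing L v (f x) * δ₀; 0, 1] : Matrix (Fin 2) (Fin 2) (LocalRing L v)) := by
    intro f hf
    refine continuous_matrix fun i j => ?_
    fin_cases i <;> fin_cases j <;> simp only [Fin.zero_eta, Fin.isValue, Fin.mk_one, Matrix.of_apply, Matrix.cons_val', Matrix.cons_val_one,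
      Matrix.cons_val_fin_one, Matrix.cons_val_zero] <;> first | exact continuous_const | exact (hι.comp hf).mul continuous_const
  have hval : (fun x => (e x : GL (Fin 2) (LocalRing L v)).val) = fun x => !![1, toLocalRing L v x * δ₀; 0, 1] := funext he
  have hinv : (fun x => ((e x : GL (Fin 2) (LocalRing L v))⁻¹).val) = fun x => !![1, toLocalRing L v (-x) * δ₀; 0, 1] :=
    funext fun x => by rw [← he (-x), (oneParam_zero_and_neg L v he).2 x]; rfl
  exact ⟨by change Continuous fun x => (e x : GL (Fin 2) (LocalRing L v)).val; rw [hval]; exact hc id continuous_id,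
    by change Continuous fun x => ((e x : GL (Fin 2) (LocalRing L v))⁻¹).val; rw [hinv]; exact hc _ continuous_neg⟩

include he in
/-- **Smoothness along `e`**: a SMOOTH `ρ` of `U(Φ₂)(L⁺_v)` satisfies ★ (e)'s clause `∀ w, ∃ s ≠ 0, ∀ x ∈ ball s, ρ (e x) w = w` (open stabiliser,
`e` continuous, `e 0 = 1`). [cite: BernsteinZelevinsky1976, §2.1] [cite: Bump1997, §4.4 p. 460] -/
theorem forall_exists_ball_oneParam_apply_eq {V : Type*} [AddCommGroup V] [Module ℂ V]
    (ρ : Representation ℂ ↥(unitaryGroupOfForm (conjLocal L (IsCMField.complexConj L) v) (cmLocalForm L 2 v)) V) (hρ : ρ.IsSmooth) (w : V) :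
    ∃ s : v.adicCompletion ↥(maximalRealSubfield L), s ≠ 0 ∧ ∀ x ∈ ball s, ρ (e x) w = w := by
  have hopen : IsOpen (e ⁻¹' (ρ.stabilizerSubgroup w : Set _)) := (hρ w).preimage (continuous_oneParam_and_zero L v he).1
  have h0 : (0 : v.adicCompletion ↥(maximalRealSubfield L)) ∈ e ⁻¹' (ρ.stabilizerSubgroup w : Set _) := by
    rw [Set.mem_preimage, SetLike.mem_coe, Representation.mem_stabilizerSubgroup, (oneParam_zero_and_neg L v he).1, map_one, Module.End.one_apply]
  obtain ⟨s, hs, hsub⟩ := exists_ball_subset_of_mem_nhds (hopen.mem_nhds h0)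
  exact ⟨s, hs, fun x hx => (Representation.mem_stabilizerSubgroup ρ w (e x)).1 (hsub hx)⟩

include he in
/-- **Injectivity of `e`** when `δ₀` is a unit (`ι_v` injective, ★ `toLocalRing_injective`). [cite: Rogawski1990, §1.10 p. 9] -/
theorem oneParam_injective (hδu : IsUnit δ₀) : Function.Injective e := by
  intro x y hxy
  have h : (e x : GL (Fin 2) (LocalRing L v)).val 0 1 = (e y : GL (Fin 2) (LocalRing L v)).val 0 1 := by rw [hxy]
  rw [he x, he y] at h
  simp only [Matrix.of_apply, Matrix.cons_val', Matrix.cons_val_one, Matrix.cons_val_zero, Matrix.cons_val_fin_one] at h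
  exact toLocalRing_injective L v (hδu.mul_left_injective h)

include he hδ₀ in
/-- **Surjectivity onto `N`** (`δ₀` a unit): for `n ∈ N` the entry `s = n₀₁` is skew (§1), so `s δ₀⁻¹` is `σ`-fixed and lies in `ι_v(F_v)` (★
`LemD1OfPlace.exists_toLocalRing_eq_of_conjLocal_eq`), `s = ι_v(p) δ₀`, `n = e(p)`. [cite: Rogawski1990, §1.10 p. 9] [cite: CasselsFrohlichANT1967, Ch. II §10] -/
theorem exists_oneParam_eq_of_mem_N (hδu : IsUnit δ₀)
    (n : ↥(unitaryGroupOfForm (conjLocal L (IsCMField.complexConj L) v) (cmLocalForm L 2 v))) (hn : n ∈ (cmBorelTriple L 2 v).N) :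
    ∃ p, e p = n := by
  set s := ((n : GL (Fin 2) (LocalRing L v)) : Matrix (Fin 2) (Fin 2) (LocalRing L v)) 0 1 with hs
  have hskew : conjLocal L (IsCMField.complexConj L) v s = -s :=
    map_entry_eq_neg_of_mem_unipotentU_two (conjLocal L (IsCMField.complexConj L) v) (cmLocalForm_eq_over L 2 v) hn
  obtain ⟨d, hd⟩ := hδu.exists_right_inv
  -- `σ(d) = -d` for the inverse `d` of the skew unit `δ₀`
  have hdskew : conjLocal L (IsCMField.complexConj L) v d = -d := by
    have h1 : conjLocal L (IsCMField.complexConj L) v δ₀ * conjLocal L (IsCMField.complexConj L) v d = 1 := by rw [← map_mul, hd, map_one]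
    rw [hδ₀] at h1
    linear_combination (-(conjLocal L (IsCMField.complexConj L) v d)) * hd + (-d) * h1
  have hfix : conjLocal L (IsCMField.complexConj L) v (s * d) = s * d := by rw [map_mul, hskew, hdskew, neg_mul_neg]
  obtain ⟨δ, hcδ, hδ⟩ := Literature.NumberTheory.Weil1982.UnitaryFinTopForm.exists_complexConj_eq_neg_ne_zero L
  obtain ⟨p, hp⟩ := Literature.NumberTheory.Automorphic.Liu2021.LemD1OfPlace.exists_toLocalRing_eq_of_conjLocal_eq L v
    (IsCMField.complexConj L) hcδ hδ (s * d) hfix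
  refine ⟨p, Subtype.ext (Units.ext ?_)⟩
  rw [he, coe_eq_of_mem_unipotentU_two_of_eq (conjLocal L (IsCMField.complexConj L) v) (cmLocalForm_eq_over L 2 v) hn, hp, ← hs,
    mul_assoc, mul_comm d δ₀, hd, mul_one]

/-! ### §4 Whittaker characters of `N` along `e` -/

include he in
/-- **The coordinate `N → F_v` (any right inverse `q` of `e` on `N`) is continuous**: `ι_w(q n) = (n₀₁ δ₀⁻¹)_w` is continuous in `n` and `ι_w : F_v → L_w`
is a closed embedding (★ `isClosedEmbedding_adicCompletionOfLiesOver`). [cite: PlatonovRapinchuk1994, §5.1] -/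
theorem continuous_coord_oneParam (hδu : IsUnit δ₀) (q : ↥(cmBorelTriple L 2 v).N → v.adicCompletion ↥(maximalRealSubfield L))
    (hq : ∀ n : ↥(cmBorelTriple L 2 v).N, e (q n) = (n : ↥(unitaryGroupOfForm (conjLocal L (IsCMField.complexConj L) v) (cmLocalForm L 2 v)))) :
    Continuous q := by
  obtain ⟨w⟩ : Nonempty (PlacesOver L v) := inferInstance
  haveI := PlacesOver.liesOver w
  obtain ⟨d, hd⟩ := hδu.exists_right_inv
  -- `ι_v (q n) = n₀₁ * d`
  have hcoord : ∀ n : ↥(cmBorelTriple L 2 v).N, toLocalRing L v (q n) =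
      ((n : ↥(unitaryGroupOfForm (conjLocal L (IsCMField.complexConj L) v) (cmLocalForm L 2 v))) : GL (Fin 2) (LocalRing L v)).val 0 1 * d := by
    intro n
    have h : (e (q n) : GL (Fin 2) (LocalRing L v)).val 0 1 =
        ((n : ↥(unitaryGroupOfForm (conjLocal L (IsCMField.complexConj L) v) (cmLocalForm L 2 v))) : GL (Fin 2) (LocalRing L v)).val 0 1 := by rw [hq n]
    rw [he (q n)] at h
    simp only [Matrix.of_apply, Matrix.cons_val', Matrix.cons_val_one, Matrix.cons_val_zero, Matrix.cons_val_fin_one] at h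
    rw [← h, mul_assoc, hd, mul_one]
  -- continuity through the closed embedding `ι_w`
  rw [(isClosedEmbedding_adicCompletionOfLiesOver (↥(maximalRealSubfield L)) L v w.1).isEmbedding.isInducing.continuous_iff]
  change Continuous fun n => toPlace v w (q n)
  have hfun : (fun n => toPlace v w (q n)) = fun n : ↥(cmBorelTriple L 2 v).N =>
      (((n : ↥(unitaryGroupOfForm (conjLocal L (IsCMField.complexConj L) v) (cmLocalForm L 2 v))) : GL (Fin 2) (LocalRing L v)).val 0 1 * d) w := by
    funext n
    rw [← toLocalRing_apply L v (q n) w, hcoord n]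
  rw [hfun]
  have hentry : Continuous fun n : ↥(cmBorelTriple L 2 v).N =>
      ((n : ↥(unitaryGroupOfForm (conjLocal L (IsCMField.complexConj L) v) (cmLocalForm L 2 v))) : GL (Fin 2) (LocalRing L v)).val 0 1 :=
    ((Units.continuous_val.comp (continuous_subtype_val.comp continuous_subtype_val)).matrix_elem 0 1)
  exact (continuous_apply w).comp (hentry.mul continuous_const)

include he hδ₀ in
/-- **WHITTAKER CHARACTERS of `N` along `e`.**  For a continuous additive character `ψ` of `F_v` and `c ∈ F_v` there is `θ : N →* ℂˣ` with OPEN kernel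
and `θ(e x) = ψ(c x)` (`δ₀` a unit): `θ = ψ(c ·) ∘ e⁻¹` on `N = e(F_v)` (§3), its kernel containing the preimage of a ball where `ψ(c ·) = 1` (★
`AddCharDuality.exists_forall_lt_apply_eq_one`) under the continuous coordinate — the `hθ` of ★ (a) `finrank_coinvariants_charTwist_cmPrincipalSeries_two_le_one`
and of ★ (b) `ker_charTwist_eq_twistedSpan`. [cite: Bump1997, §4.4 p. 460] [cite: Rogawski1990, §11.1 p. 161] -/
theorem exists_charTwist_oneParam (hδu : IsUnit δ₀) (ψ : AddChar (v.adicCompletion ↥(maximalRealSubfield L)) Circle) (hψ : Continuous ψ)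
    (c : v.adicCompletion ↥(maximalRealSubfield L)) :
    ∃ θ : ↥(cmBorelTriple L 2 v).N →* ℂˣ, IsOpen ((θ.ker : Subgroup ↥(cmBorelTriple L 2 v).N) : Set ↥(cmBorelTriple L 2 v).N) ∧
      ∀ x, ((θ ⟨e x, oneParam_mem_N L v he x⟩ : ℂˣ) : ℂ) = (ψ (c * x) : ℂ) := by
  -- the coordinate `q : N → F_v`, `e (q n) = n`
  have hsurj := exists_oneParam_eq_of_mem_N L v hδ₀ he hδu
  let q : ↥(cmBorelTriple L 2 v).N → v.adicCompletion ↥(maximalRealSubfield L) := fun n => Classical.choose (hsurj n.1 n.2)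
  have hq : ∀ n : ↥(cmBorelTriple L 2 v).N, e (q n) = (n : ↥(unitaryGroupOfForm (conjLocal L (IsCMField.complexConj L) v) (cmLocalForm L 2 v))) :=
    fun n => Classical.choose_spec (hsurj n.1 n.2)
  have hinj := oneParam_injective L v he hδu
  have hqe : ∀ x, q ⟨e x, oneParam_mem_N L v he x⟩ = x := fun x => hinj (hq ⟨e x, oneParam_mem_N L v he x⟩)
  have hq1 : q 1 = 0 := hinj (by rw [hq, (oneParam_zero_and_neg L v he).1]; rfl)
  have hqmul : ∀ m n : ↥(cmBorelTriple L 2 v).N, q (m * n) = q m + q n := fun m n =>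
    hinj (by rw [hq, oneParam_add L v he, hq, hq]; rfl)
  -- the character
  let θ : ↥(cmBorelTriple L 2 v).N →* ℂˣ :=
    { toFun := fun n => Circle.toUnits (ψ (c * q n))
      map_one' := by rw [hq1, mul_zero, AddChar.map_zero_eq_one, map_one]
      map_mul' := fun m n => by rw [hqmul, mul_add, AddChar.map_add_eq_mul, map_mul] }
  refine ⟨θ, ?_, fun x => ?_⟩
  · -- open kernel: it contains `q ⁻¹' {y | ψ (c y) = 1}`, a neighbourhood of `1`
    obtain ⟨γ, hγ⟩ := AddCharDuality.exists_forall_lt_apply_eq_one hψ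
    have hqc : Continuous q := continuous_coord_oneParam L v he hδu q hq
    have hW : {y : v.adicCompletion ↥(maximalRealSubfield L) | ψ (c * y) = 1} ∈ 𝓝 (0 : v.adicCompletion ↥(maximalRealSubfield L)) := by
      have h1 : {z : v.adicCompletion ↥(maximalRealSubfield L) | ValuativeRel.valuation _ z < γ} ∈
          𝓝 (c * 0 : v.adicCompletion ↥(maximalRealSubfield L)) := by
        rw [mul_zero]
        exact (IsValuativeTopology.mem_nhds_zero_iff _).2 ⟨γ, subset_rfl⟩
      have h2 := (continuous_const.mul continuous_id : Continuous fun y : v.adicCompletion ↥(maximalRealSubfield L) => c * y)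
        |>.continuousAt.preimage_mem_nhds h1
      exact Filter.mem_of_superset h2 fun y hy => hγ _ hy
    have hN1 : q ⁻¹' {y | ψ (c * y) = 1} ∈ 𝓝 (1 : ↥(cmBorelTriple L 2 v).N) :=
      hqc.continuousAt.preimage_mem_nhds (by rw [hq1]; exact hW)
    refine Subgroup.isOpen_of_mem_nhds _ (Filter.mem_of_superset hN1 fun n hn => ?_)
    rw [SetLike.mem_coe, MonoidHom.mem_ker]
    change Circle.toUnits (ψ (c * q n)) = 1
    rw [show ψ (c * q n) = 1 from hn, map_one]
  · change ((Circle.toUnits (ψ (c * q ⟨e x, oneParam_mem_N L v he x⟩)) : ℂˣ) : ℂ) = (ψ (c * x) : ℂ)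
    rw [hqe]
    rfl

/-- **Non-triviality**: a character `θ` of `N` reading `θ(e x) = ψ(c x)` with `c ≠ 0` and `ψ` non-trivial (`ψ x₀ ≠ 1`) is `≠ 1` (`θ(e (x₀ ∕ c)) = ψ x₀`) —
the `hθ1` of ★ (a). [cite: Bump1997, §4.4 p. 460] -/
theorem charTwist_oneParam_ne_one {θ : ↥(cmBorelTriple L 2 v).N →* ℂˣ} {ψ : AddChar (v.adicCompletion ↥(maximalRealSubfield L)) Circle}
    {c : v.adicCompletion ↥(maximalRealSubfield L)} (hθ : ∀ x, ((θ ⟨e x, oneParam_mem_N L v he x⟩ : ℂˣ) : ℂ) = (ψ (c * x) : ℂ))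
    (hc : c ≠ 0) {x₀ : v.adicCompletion ↥(maximalRealSubfield L)} (hx₀ : ψ x₀ ≠ 1) : θ ≠ 1 := by
  intro h1
  have h := hθ (c⁻¹ * x₀)
  rw [h1, MonoidHom.one_apply, Units.val_one, mul_inv_cancel_left₀ hc] at h
  exact hx₀ (Circle.coe_eq_one.1 h.symm)

/-! ### §5 Torus rescaling: `Ad d(z, (σz)⁻¹)` multiplies the parameter by the norm `σ(z) z` -/

include he in
/-- **TORUS RESCALING.**  For a unit `z` of `E_v`, the torus element `t = d(z, (σz)⁻¹) ∈ U(Φ₂)(L⁺_v)` (§1) conjugates the one-parameter group by a NORM: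
`t · e(x) · t⁻¹ = e(n_z x)`, `ι_v(n_z) = σ(z) z` (`σ`-fixed, hence in `ι_v(F_v)`) — with ★ (b) `twistedSpan_rescale` + `twistedSpan_eq_top_iff_of_equivariant`
(`φ = ρ(t)`): «`ψ_a`-genericity depends only on `a` modulo norms». [cite: Rogawski1990, §11.1 p. 161] [cite: LabesseLanglands1979] -/
theorem exists_torus_conj_oneParam {z : LocalRing L v} (hz : IsUnit z) :
    ∃ (n : v.adicCompletion ↥(maximalRealSubfield L))
      (t : ↥(unitaryGroupOfForm (conjLocal L (IsCMField.complexConj L) v) (cmLocalForm L 2 v))),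
      toLocalRing L v n = conjLocal L (IsCMField.complexConj L) v z * z ∧ ∀ x, t * e x * t⁻¹ = e (n * x) := by
  -- `n` with `ι_v n = σ(z) z`
  obtain ⟨δ, hcδ, hδ⟩ := Literature.NumberTheory.Weil1982.UnitaryFinTopForm.exists_complexConj_eq_neg_ne_zero L
  have hfix : conjLocal L (IsCMField.complexConj L) v (conjLocal L (IsCMField.complexConj L) v z * z) =
      conjLocal L (IsCMField.complexConj L) v z * z := by
    rw [map_mul, conjLocal_conjLocal_cm, mul_comm]
  obtain ⟨n, hn⟩ := Literature.NumberTheory.Automorphic.Liu2021.LemD1OfPlace.exists_toLocalRing_eq_of_conjLocal_eq L v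
    (IsCMField.complexConj L) hcδ hδ _ hfix
  -- the torus element
  let t : ↥(unitaryGroupOfForm (conjLocal L (IsCMField.complexConj L) v) (cmLocalForm L 2 v)) :=
    ⟨glDiagonal 2 (LocalRing L v) ![hz.unit, (Units.map (conjLocal L (IsCMField.complexConj L) v : LocalRing L v →* LocalRing L v) hz.unit)⁻¹],
      glDiagonal_two_mem_unitaryGroupOfForm_of_eq (conjLocal L (IsCMField.complexConj L) v) (cmLocalForm_eq_over L 2 v) hz.unit
        (by rw [IsUnit.unit_spec]; exact conjLocal_conjLocal_cm L v z)⟩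
  refine ⟨n, t, hn, fun x => Subtype.ext (Units.ext ?_)⟩
  change (glDiagonal 2 (LocalRing L v) ![hz.unit, (Units.map (conjLocal L (IsCMField.complexConj L) v : LocalRing L v →* LocalRing L v) hz.unit)⁻¹]
      * (e x : GL (Fin 2) (LocalRing L v)) *
      (glDiagonal 2 (LocalRing L v) ![hz.unit, (Units.map (conjLocal L (IsCMField.complexConj L) v : LocalRing L v →* LocalRing L v) hz.unit)⁻¹])⁻¹).val =
    (e (n * x) : GL (Fin 2) (LocalRing L v)).val
  rw [coe_glDiagonal_conj_unipotent_two _ _ (he x), he (n * x), inv_inv, Units.coe_map, MonoidHom.coe_coe, IsUnit.unit_spec, map_mul, hn]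
  refine Matrix.ext fun i j => ?_
  fin_cases i <;> fin_cases j <;> simp only [Fin.zero_eta, Fin.isValue, Fin.mk_one, Matrix.of_apply, Matrix.cons_val', Matrix.cons_val_one,
    Matrix.cons_val_fin_one, Matrix.cons_val_zero]
  ring

/-! ### §6 The outer similitude `diag(ι_v a, 1)` rescales the parameter by `a` -/

omit [IsCMField L] in
/-- `ι_v(a)` is a unit of `E_v` for `a ≠ 0` (`ι_v` is a ring map out of a field). [cite: Rogawski1990, §1.9 p. 8] -/
theorem isUnit_toLocalRing_of_ne_zero {a : v.adicCompletion ↥(maximalRealSubfield L)} (ha : a ≠ 0) : IsUnit (toLocalRing L v a) :=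
  (isUnit_iff_ne_zero.2 ha).map _

include he in
/-- **OUTER SIMILITUDE RESCALING.**  For `a ∈ F_v^×` the similitude `T_a = diag(ι_v a, 1)` of `(Φ₂)_v` (★ `formCongr_glDiagonal_two_eq_smul`) acts through ★
`cmDatumLocalCongr` by `e(x) ↦ e(a x)` — with ★ (b) `twistedSpan_comp`∕`_rescale`: «`Ad(diag(a₀,1))` moves `ψ`-genericity to `ψ_{a₀}`-genericity».
[cite: Rogawski1990, §11.1 p. 161] [cite: LabesseLanglands1979] -/
theorem cmDatumLocalCongr_glDiagonal_oneParam {a : v.adicCompletion ↥(maximalRealSubfield L)} (ha : a ≠ 0)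
    (x : v.adicCompletion ↥(maximalRealSubfield L)) :
    cmDatumLocalCongr L v (glDiagonal 2 (LocalRing L v) ![(isUnit_toLocalRing_of_ne_zero L v ha).unit, 1])
        (isUnit_toLocalRing_of_ne_zero L v ha)
        (formCongr_glDiagonal_two_eq_smul L v (isUnit_toLocalRing_of_ne_zero L v ha) (conjLocal_toLocalRing (IsCMField.complexConj L) v a))
        (e x) = e (a * x) := by
  apply Subtype.ext
  apply Units.ext
  change (cmDatumLocalCongr L v (glDiagonal 2 (LocalRing L v) ![(isUnit_toLocalRing_of_ne_zero L v ha).unit, 1])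
      (isUnit_toLocalRing_of_ne_zero L v ha)
      (formCongr_glDiagonal_two_eq_smul L v (isUnit_toLocalRing_of_ne_zero L v ha) (conjLocal_toLocalRing (IsCMField.complexConj L) v a))
      (e x)).val.val = (e (a * x) : GL (Fin 2) (LocalRing L v)).val
  rw [coe_cmDatumLocalCongr_apply, coe_glDiagonal_conj_unipotent_two _ _ (he x), he (a * x), inv_one, Units.val_one, IsUnit.unit_spec, map_mul]
  refine Matrix.ext fun i j => ?_
  fin_cases i <;> fin_cases j <;> simp only [Fin.zero_eta, Fin.isValue, Fin.mk_one, Matrix.of_apply, Matrix.cons_val', Matrix.cons_val_one,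
    Matrix.cons_val_fin_one, Matrix.cons_val_zero]
  ring

end CM

end Summit.HodgeConjecture.HodgeConjecture.R90.S4

end
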